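import Literature.Computability.Cryptography.InaccessibleEntropyUOWHFInverterBricks
import HarnessLib

/-!
# One-way functions ⇒ UOWHF, machine layer VII: the inverting machine

Topic `Literature/Computability/Cryptography`; fifteenth file of the "one-way functions ⇒ universal one-way
hash functions" line (Haitner–Holenstein–Reingold–Vadhan–Wee 2020, proof of Thm. 5.1). From a string-level
two-stage adversary `(A₀, A)` against the family `HHRVW.family p f` (target coins `q(n)`) this file assembles
ONE probabilistic machine `inverter f q p A₀ A : RandAlg` inverting `f` on `(1ⁿ, y)`, and proves that it is
PPT and that its run function is the explicit string function `Inv.out` (the composite of the reductions of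
Claim 4.6, Lemmas 5.3–5.7 and the two planting steps, with the grid index `j` and the chain level `r` read off
the coins):

* `Inv.L`, `Inv.off`, `Inv.len`, `Inv.pre`, `Inv.fld'` — the layout of the coin string: `j`-bits, `r`-bits,
  `x`, `i`-bits, `κ₀`, `j₁`-bits, `w`, `g₂`, `g₃`, `ρ`, own chain keys `ysj`, index coins `ysAll`, then `ω`;
* `Inv.delta … Inv.out` — the string semantics: `δ = y ⊕ f x`, `κ = fixup(κ₀, δ, i)`, `z = x κ i` planted at
  coordinate `j₁` of `w`, `v = w' g₂ g₃`, target `x₀ = fitLen d (A₀ ρ)`, keys `kbP = ysAll[j ↦ ysj]`, the level-`r`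
  state `st₀` of `x₀`, challenge key `yk = v ⊕ st₀`, keys `kb' = kbP[(j,r) ↦ yk]`, answer
  `x₁ = fitLen d (A(1ⁿ, 1ⁿ0kb', ρ; ω))`, its level-`r` state `st₁`, `v' = yk ⊕ st₁`, `x' = ` first `n` bits of
  block `j₁` of `v'`, and the output `x'` if `f x' = y`, else `x`;
* the bricks and `invP_apply : invP … ⟨⟨1ⁿ, y⟩, c⟩ = Inv.out … y c` (for `|y| = n`, enough coins, `K ≤ p(n)`),
  `invP_mem_FP`; the machine `inverter` with `inverter_run`, `isPPT_inverter`.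

All statements proved; no named facts.

## References

* I. Haitner, T. Holenstein, O. Reingold, S. Vadhan, H. Wee, *Inaccessible Entropy II: IE Functions and
  Universal One-Way Hashing*, Theory of Computing 16(8) (2020), Claim 4.6, Lemmas 5.3–5.7, proof of Thm. 5.1,
  Step 5 ("a uniform adversary … tries all polynomially many candidates" — here: guesses one).
* O. Goldreich, *Foundations of Cryptography I*, CUP 2001, §1.3.2 (PPT), §2.2.1 (inverters get `(1ⁿ, y)`).
-/

namespace Literature.Computability.Cryptography

namespace HHRVW

open _root_.Computability Complexity Complexity.Brick Complexity.Plumb Complexity.UExpr AffineStr Sz Polynomial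
open Literature.Computability.Learning (xorStrFn xorStrFn_apply xorStrFn_mem_FP)

namespace Inv

section Spec

variable (f : List Bool → List Bool) (n : ℕ) (q p : Polynomial ℕ) (A₀ : List Bool → List Bool) (A : RandAlg (List Bool) (List Bool))

/-- **The coin layout**: the length of field `k` (twelve fields before `ω`: `j`-bits, `r`-bits, `x`, `i`-bits,
`κ₀`, `j₁`-bits, `w`, `g₂`, `g₃`, `ρ`, own chain keys, index coins). [cite: HaitnerEtAl2020, Claim 4.6 with Lemmas 5.3–5.7] -/
def len (k : ℕ) : ℕ :=
  match k with
  | 0 => aJ n | 1 => aR n | 2 => n | 3 => a n | 4 => lK n | 5 => logt n | 6 => t n * d0 n | 7 => G2 n | 8 => G3 n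
  | 9 => q.eval n | 10 => (R n + 1) * N n | 11 => p.eval n | _ => 0

/-- The list of the twelve field lengths. [folklore] -/
def L : List ℕ := (List.range 12).map (len n q p)

/-- Offset of field `k`. [folklore] -/
def off (k : ℕ) : ℕ := ((L n q p).take k).sum

/-- The total length of the fields (the coins of `A` follow). [folklore] -/
def pre : ℕ := (L n q p).sum

variable (c : List Bool)

/-- Field `k` of the coins. [folklore] -/
def fld' (k : ℕ) : List Bool := fld c (off n q p k) (len n q p k)

/-- The grid index `j < J + 1 = 2^{aJ}`. [cite: HaitnerEtAl2020, proof of Thm. 5.1, Step 5] -/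
def jOf : ℕ := min (bitsToNat (fld' n q p c 0)) (Jp1 n)
/-- The chain level `r ≤ R`. [cite: HaitnerEtAl2020, Lemma 5.7] -/
def rOf : ℕ := min (bitsToNat (fld' n q p c 1)) (R n)
/-- The planted `x`. [cite: HaitnerEtAl2020, Claim 4.6] -/
def xs : List Bool := fld' n q p c 2
/-- The prefix length `i < M`. [cite: HaitnerEtAl2020, Claim 4.6] -/
def iOf : ℕ := min (bitsToNat (fld' n q p c 3)) (M n)
/-- The raw hash key `κ₀`. [cite: HaitnerEtAl2020, Claim 4.6] -/
def κ0 : List Bool := fld' n q p c 4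
/-- The planted coordinate `j₁ < t`. [cite: HaitnerEtAl2020, Lemma 5.3 (ii)] -/
def j1 : ℕ := min (bitsToNat (fld' n q p c 5)) (t n)
/-- The coins of `A`. [folklore] -/
def ω : List Bool := c.drop (pre n q p)

variable (y : List Bool)

/-- `δ = y ⊕ f x`. [cite: HaitnerEtAl2020, Claim 4.6] -/
def delta : List Bool := List.zipWith xor y (f (xs n q p c))
/-- The fixed-up key. [cite: HaitnerEtAl2020, Claim 4.6] -/
def kap : List Bool := fixupStr n (κ0 n q p c) (delta f n q p c y) (iOf n q p c)
/-- The planted point `z = x κ i`. [cite: HaitnerEtAl2020, Claim 4.6] -/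
def zstr : List Bool := xs n q p c ++ kap f n q p c y ++ fld' n q p c 3
/-- The `F₃`-input `v = w[j₁ ↦ z] g₂ g₃`. [cite: HaitnerEtAl2020, Lemmas 5.3 (ii), 5.4 (ii), 5.5] -/
def vstr : List Bool := splice (d0 n) (j1 n q p c) (zstr f n q p c y) (fld' n q p c 6) ++ fld' n q p c 7 ++ fld' n q p c 8
/-- The target `x₀ = fitLen d (A₀ ρ)`. [cite: Goldreich2004, Def. 6.4.19 (3)] -/
def x0s : List Bool := fitLen (d n) (A₀ (fld' n q p c 9))
/-- The keys with the own chain-key vector planted at component `j`. [cite: HaitnerEtAl2020, proof of Thm. 5.1, Step 5 (iii)] -/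
def kbP : List Bool := splice ((R n + 1) * N n) (jOf n q p c) (fld' n q p c 10) (fld' n q p c 11)
/-- The level-`r` state of the target. [cite: HaitnerEtAl2020, Lemma 5.7] -/
def st0 : List Bool := chainSt f n (jOf n q p c) (kbP n q p c) (x0s n q p A₀ c) (rOf n q p c)
/-- The challenge key `yk = v ⊕ st₀`. [cite: HaitnerEtAl2020, Lemma 5.6] -/
def yk : List Bool := List.zipWith xor (vstr f n q p c y) (st0 f n q p A₀ c)
/-- The keys with the challenge planted at `(j, r)`. [cite: HaitnerEtAl2020, Lemma 5.7] -/
def kb1 : List Bool := splice (N n) (jOf n q p c * (R n + 1) + rOf n q p c) (yk f n q p A₀ c y) (kbP n q p c)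
/-- The index handed to `A`. [cite: Goldreich2004, Def. 6.4.19 (3)] -/
def sIdx : List Bool := ones n ++ false :: kb1 f n q p A₀ c y
/-- The answer `x₁ = fitLen d (A(1ⁿ, s, ρ; ω))`. [cite: Goldreich2004, Def. 6.4.19 (3)] -/
def x1s : List Bool :=
  fitLen (d n) (A.run (boolPair (unaryEncodeNat n) (boolPair (sIdx f n q p A₀ c y) (fld' n q p c 9))) (ω n q p c))
/-- The level-`r` state of the answer. [cite: HaitnerEtAl2020, Lemma 5.7] -/
def st1 : List Bool := chainSt f n (jOf n q p c) (kb1 f n q p A₀ c y) (x1s f n q p A₀ A c y) (rOf n q p c)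
/-- `v' = yk ⊕ st₁`. [cite: HaitnerEtAl2020, Lemma 5.6] -/
def v1 : List Bool := List.zipWith xor (yk f n q p A₀ c y) (st1 f n q p A₀ A c y)
/-- The candidate preimage: the first `n` bits of block `j₁` of `v'`. [cite: HaitnerEtAl2020, Claim 4.6 with Lemma 5.3 (ii)] -/
def xraw : List Bool := ((v1 f n q p A₀ A c y).drop (j1 n q p c * d0 n)).take n
/-- **The output**: `x'` if it inverts, else the planted `x`. [cite: HaitnerEtAl2020, Claim 4.6] -/
def out : List Bool := if f (xraw f n q p A₀ A c y) = y then xraw f n q p A₀ A c y else xs n q p c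

end Spec

/-! ### The bricks -/

section Bricks

variable (f : List Bool → List Bool) (q p : Polynomial ℕ) (A₀ : List Bool → List Bool) (A : RandAlg (List Bool) (List Bool))

/-- The length bricks of the layout. [folklore] -/
noncomputable def gs : List (List Bool → List Bool) :=
  [WszF E.aJ, WszF E.aR, WszF (var 0), WszF E.a, WszF E.lK, WszF E.logt, WszF (mul E.t E.d0), WszF E.G2, WszF E.G3,
    WpolyF q, WszF (mul (add E.R (cst 1)) E.N), WpolyF p]

/-- Field brick `k`. [folklore] -/
noncomputable def fF (k : ℕ) : List Bool → List Bool := fldF (gs q p) k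
/-- `ω`. [folklore] -/
noncomputable def ωF : List Bool → List Bool := restF (gs q p)
/-- `1ʲ`. [folklore] -/
noncomputable def jU : List Bool → List Bool := binToUnaryFn ∘ fanoutFn (WszF E.Jp1) (fF q p 0)
/-- `1ʳ`. [folklore] -/
noncomputable def rU : List Bool → List Bool := binToUnaryFn ∘ fanoutFn (WszF E.R) (fF q p 1)
/-- `1ⁱ`. [folklore] -/
noncomputable def iU : List Bool → List Bool := binToUnaryFn ∘ fanoutFn (WszF E.M) (fF q p 3)
/-- `1^{j₁}`. [folklore] -/
noncomputable def j1U : List Bool → List Bool := binToUnaryFn ∘ fanoutFn (WszF E.t) (fF q p 5)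
/-- `δ`. [cite: HaitnerEtAl2020, Claim 4.6] -/
noncomputable def deltaF : List Bool → List Bool := xorStrFn ∘ fanoutFn WyF (f ∘ fF q p 2)
/-- `κ`. [cite: HaitnerEtAl2020, Claim 4.6] -/
noncomputable def kapF : List Bool → List Bool := fixupP ∘ fanoutFn WnF (fanoutFn (fF q p 4) (fanoutFn (deltaF f q p) (iU q p)))
/-- `z`. [cite: HaitnerEtAl2020, Claim 4.6] -/
noncomputable def zF : List Bool → List Bool := catF (catF (fF q p 2) (kapF f q p)) (fF q p 3)
/-- `v`. [cite: HaitnerEtAl2020, Lemma 5.6] -/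
noncomputable def vF : List Bool → List Bool :=
  catF (catF (spliceP ∘ fanoutFn (WszF E.d0) (fanoutFn (j1U q p) (fanoutFn (zF f q p) (fF q p 6)))) (fF q p 7)) (fF q p 8)
/-- `x₀`. [cite: Goldreich2004, Def. 6.4.19 (3)] -/
noncomputable def x0F : List Bool → List Bool :=
  catF (takeFn ∘ fanoutFn (WszF E.d) (A₀ ∘ fF q p 9)) (Kannan.zerosFn ∘ dropFn ∘ fanoutFn (A₀ ∘ fF q p 9) (WszF E.d))
/-- `kbP`. [cite: HaitnerEtAl2020, proof of Thm. 5.1, Step 5 (iii)] -/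
noncomputable def kbPF : List Bool → List Bool :=
  spliceP ∘ fanoutFn (WszF (mul (add E.R (cst 1)) E.N)) (fanoutFn (jU q p) (fanoutFn (fF q p 10) (fF q p 11)))
/-- The chain record `⟨⟨⟨1ⁿ, ⟨kb, x⟩⟩, 1ʲ⟩, 1ʳ⟩` from bricks for `kb` and `x`. [folklore] -/
noncomputable def chRec (kbB xB : List Bool → List Bool) : List Bool → List Bool :=
  fanoutFn (fanoutFn (fanoutFn WnF (fanoutFn kbB xB)) (jU q p)) (rU q p)
/-- `st₀`. [cite: HaitnerEtAl2020, Lemma 5.7] -/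
noncomputable def st0F : List Bool → List Bool := chainUptoP f ∘ chRec q p (kbPF q p) (x0F q p A₀)
/-- `yk`. [cite: HaitnerEtAl2020, Lemma 5.6] -/
noncomputable def ykF : List Bool → List Bool := xorStrFn ∘ fanoutFn (vF f q p) (st0F f q p A₀)
/-- `kb'`. [cite: HaitnerEtAl2020, Lemma 5.7] -/
noncomputable def kb1F : List Bool → List Bool :=
  spliceP ∘ fanoutFn (WszF E.N) (fanoutFn (catF (HashBricks.umulFn ∘ fanoutFn (jU q p) (WszF (add E.R (cst 1)))) (rU q p))
    (fanoutFn (ykF f q p A₀) (kbPF q p)))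
/-- The index `1ⁿ 0 kb'`. [cite: Goldreich2004, Def. 6.4.19 (3)] -/
noncomputable def sF : List Bool → List Bool := catF WnF (List.cons false ∘ kb1F f q p A₀)
/-- Running `A`: `⟨inp, ω⟩ ↦ A.run inp ω`. [cite: Goldreich2001, §1.3.2] -/
def bFn : List Bool → List Bool := Function.uncurry A.run ∘ boolUnpair
/-- `x₁`. [cite: Goldreich2004, Def. 6.4.19 (3)] -/
noncomputable def x1F : List Bool → List Bool :=
  let raw := bFn A ∘ fanoutFn (fanoutFn WnF (fanoutFn (sF f q p A₀) (fF q p 9))) (ωF q p)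
  catF (takeFn ∘ fanoutFn (WszF E.d) raw) (Kannan.zerosFn ∘ dropFn ∘ fanoutFn raw (WszF E.d))
/-- `st₁`. [cite: HaitnerEtAl2020, Lemma 5.7] -/
noncomputable def st1F : List Bool → List Bool := chainUptoP f ∘ chRec q p (kb1F f q p A₀) (x1F f q p A₀ A)
/-- `v'`. [cite: HaitnerEtAl2020, Lemma 5.6] -/
noncomputable def v1F : List Bool → List Bool := xorStrFn ∘ fanoutFn (ykF f q p A₀) (st1F f q p A₀ A)
/-- `x'`. [cite: HaitnerEtAl2020, Claim 4.6] -/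
noncomputable def xrawF : List Bool → List Bool :=
  takeFn ∘ fanoutFn WnF (dropFn ∘ fanoutFn (HashBricks.umulFn ∘ fanoutFn (j1U q p) (WszF E.d0)) (v1F f q p A₀ A))
/-- **The inverter brick**. [cite: HaitnerEtAl2020, Claim 4.6] -/
noncomputable def invP : List Bool → List Bool :=
  iteFn (eqPairFn ∘ fanoutFn (f ∘ xrawF f q p A₀ A) WyF) (xrawF f q p A₀ A) (fF q p 2)

end Bricks

/-! ### Values of the bricks on the record `⟨⟨1ⁿ, y⟩, c⟩` -/

section Values

variable {f : List Bool → List Bool} {q p : Polynomial ℕ} {A₀ : List Bool → List Bool} {A : RandAlg (List Bool) (List Bool)}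
variable {n : ℕ} {y c : List Bool}

/-- The layout, spelled out. [folklore] -/
theorem L_eq (n : ℕ) (q p : Polynomial ℕ) :
    L n q p = [len n q p 0, len n q p 1, len n q p 2, len n q p 3, len n q p 4, len n q p 5, len n q p 6, len n q p 7,
      len n q p 8, len n q p 9, len n q p 10, len n q p 11] := by simp [L, List.range_succ]

/-- `|L| = 12`. [folklore] -/
theorem length_L (n : ℕ) (q p : Polynomial ℕ) : (L n q p).length = 12 := by simp [L]

/-- `L[k] = len k`. [folklore] -/
theorem getElem_L (n : ℕ) (q p : Polynomial ℕ) {k : ℕ} (hk : k < (L n q p).length) : (L n q p)[k] = len n q p k := by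
  simp [L]

/-- The length bricks evaluate to the layout. [folklore] -/
theorem gs_W (q p : Polynomial ℕ) (n : ℕ) (y c : List Bool) :
    List.Forall₂ (fun g l => g (Wrec n y c) = ones l) (gs q p) (L n q p) := by
  rw [L_eq]
  simp only [gs, len]
  refine List.Forall₂.cons ?_ (List.Forall₂.cons ?_ (List.Forall₂.cons ?_ (List.Forall₂.cons ?_ (List.Forall₂.cons ?_
    (List.Forall₂.cons ?_ (List.Forall₂.cons ?_ (List.Forall₂.cons ?_ (List.Forall₂.cons ?_ (List.Forall₂.cons ?_
    (List.Forall₂.cons ?_ (List.Forall₂.cons ?_ List.Forall₂.nil)))))))))))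
  all_goals first | (rw [WpolyF_W]) | (rw [WszF_W]; simp)

/-- Value of field brick `k < 12`. [folklore] -/
theorem fF_W (q p : Polynomial ℕ) (n : ℕ) (y c : List Bool) {k : ℕ} (hk : k < 12) : fF q p k (Wrec n y c) = fld' n q p c k := by
  rw [fF, fldF_W n y c (gs_W q p n y c) (by rw [length_L]; exact hk), getElem_L, fld', off]

/-- Value of `ωF`. [folklore] -/
theorem ωF_W (q p : Polynomial ℕ) (n : ℕ) (y c : List Bool) : ωF q p (Wrec n y c) = ω n q p c := by
  rw [ωF, restF_W n y c (gs_W q p n y c), ω, pre]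

/-- The numeral of a field of `ℓ` bits is below `2^ℓ`. [folklore] -/
theorem bitsToNat_fld'_lt (n : ℕ) (q p : Polynomial ℕ) (c : List Bool) (k : ℕ) : bitsToNat (fld' n q p c k) < 2 ^ len n q p k :=
  (bitsToNat_lt _).trans_le (Nat.pow_le_pow_right (by norm_num) (by rw [fld', fld, List.length_take]; exact min_le_left _ _))

/-- Value of `jU`: `1ʲ`. [folklore] -/
theorem jU_W (q p : Polynomial ℕ) (n : ℕ) (y c : List Bool) : jU q p (Wrec n y c) = ones (jOf n q p c) := by
  rw [jU, Function.comp_apply, fanoutFn_apply, WszF_W, fF_W q p n y c (by norm_num), binToUnaryFn_boolPair, jOf]; simp [ones]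

/-- Value of `rU`: `1ʳ`. [folklore] -/
theorem rU_W (q p : Polynomial ℕ) (n : ℕ) (y c : List Bool) : rU q p (Wrec n y c) = ones (rOf n q p c) := by
  rw [rU, Function.comp_apply, fanoutFn_apply, WszF_W, fF_W q p n y c (by norm_num), binToUnaryFn_boolPair, rOf]; simp [ones]

/-- Value of `iU`: `1ⁱ`. [folklore] -/
theorem iU_W (q p : Polynomial ℕ) (n : ℕ) (y c : List Bool) : iU q p (Wrec n y c) = ones (iOf n q p c) := by
  rw [iU, Function.comp_apply, fanoutFn_apply, WszF_W, fF_W q p n y c (by norm_num), binToUnaryFn_boolPair, iOf]; simp [ones]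

/-- Value of `j1U`: `1^{j₁}`. [folklore] -/
theorem j1U_W (q p : Polynomial ℕ) (n : ℕ) (y c : List Bool) : j1U q p (Wrec n y c) = ones (j1 n q p c) := by
  rw [j1U, Function.comp_apply, fanoutFn_apply, WszF_W, fF_W q p n y c (by norm_num), binToUnaryFn_boolPair, j1]; simp [ones]

/-- Lengths of the fields when the coins are long enough. [folklore] -/
theorem length_fld' {n : ℕ} {q p : Polynomial ℕ} {c : List Bool} (hc : pre n q p ≤ c.length) {k : ℕ} (hk : k < 12) :
    (fld' n q p c k).length = len n q p k := by
  rw [fld', fld, List.length_take, List.length_drop, min_eq_left]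
  have hsum : off n q p k + len n q p k ≤ pre n q p := by
    have hk' : k < (L n q p).length := by rw [length_L]; exact hk
    rw [off, pre, ← getElem_L n q p hk']
    have := List.sum_take_add_sum_drop (L n q p) k
    have h2 : (L n q p)[k] ≤ ((L n q p).drop k).sum := by
      rw [List.drop_eq_getElem_cons hk', List.sum_cons]; exact Nat.le_add_right _ _
    omega
  omega

/-- `j < J + 1`. [folklore] -/
theorem jOf_lt : jOf n q p c < Jp1 n := by
  rw [jOf]
  refine lt_of_le_of_lt (min_le_left _ _) ?_
  have := bitsToNat_fld'_lt n q p c 0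
  rwa [show len n q p 0 = aJ n from rfl, ← Jp1_eq] at this

/-- `r ≤ R`. [folklore] -/
theorem rOf_le : rOf n q p c ≤ R n := min_le_right _ _

/-- `j₁ < t`. [folklore] -/
theorem j1_lt : j1 n q p c < t n := by
  rw [j1]; refine lt_of_le_of_lt (min_le_left _ _) ?_
  have := bitsToNat_fld'_lt n q p c 5
  rwa [show len n q p 5 = logt n from rfl, ← t_eq_pow] at this

section WellFormed

variable (hy : y.length = n) (hc : pre n q p ≤ c.length) (hf : IsLengthPreserving f) (hK : K n ≤ p.eval n)

/-- Field lengths, concretely. [folklore] -/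
theorem len_eq (n : ℕ) (q p : Polynomial ℕ) :
    len n q p 0 = aJ n ∧ len n q p 1 = aR n ∧ len n q p 2 = n ∧ len n q p 3 = a n ∧ len n q p 4 = lK n ∧ len n q p 5 = logt n ∧
      len n q p 6 = t n * d0 n ∧ len n q p 7 = G2 n ∧ len n q p 8 = G3 n ∧ len n q p 9 = q.eval n ∧
      len n q p 10 = (R n + 1) * N n ∧ len n q p 11 = p.eval n :=
  ⟨rfl, rfl, rfl, rfl, rfl, rfl, rfl, rfl, rfl, rfl, rfl, rfl⟩

include hy hc hf in
/-- Value of `deltaF`. [folklore] -/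
theorem deltaF_W : deltaF f q p (Wrec n y c) = delta f n q p c y := by
  have hx : (fld' n q p c 2).length = n := by rw [length_fld' hc (by norm_num)]; exact (len_eq n q p).2.2.1
  rw [deltaF, Function.comp_apply, fanoutFn_apply, WyF_W, Function.comp_apply, fF_W q p n y c (by norm_num),
    xorStrFn_boolPair_eq_zipWith (by rw [hf, hy, hx]), delta, xs]

include hy hc hf in
/-- `|δ| = n`. [folklore] -/
theorem length_delta : (delta f n q p c y).length = n := by
  have hx : (fld' n q p c 2).length = n := by rw [length_fld' hc (by norm_num)]; exact (len_eq n q p).2.2.1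
  rw [delta, List.length_zipWith, hf, hy, xs, hx, min_self]

include hc in
/-- `|κ₀| = ℓK`. [folklore] -/
theorem length_κ0 : (κ0 n q p c).length = lK n := by rw [κ0, length_fld' hc (by norm_num)]; exact (len_eq n q p).2.2.2.2.1

include hy hc hf in
/-- Value of `kapF`. [cite: HaitnerEtAl2020, Claim 4.6] -/
theorem kapF_W : kapF f q p (Wrec n y c) = kap f n q p c y := by
  rw [kapF, Function.comp_apply, fanoutFn_apply, fanoutFn_apply, fanoutFn_apply, WnF_W, fF_W q p n y c (by norm_num),
    deltaF_W hy hc hf, iU_W, ← κ0, fixupP_apply (by rw [length_κ0 hc]) (length_delta hy hc hf), kap]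

include hy hc hf in
/-- `|κ| = ℓK` (the fix-up keeps full rows). [folklore] -/
theorem length_kap : (kap f n q p c y).length = lK n := by
  rw [kap, fixupStr, BitCodec.length_ccat_blocks (m := n + 1), lK]
  intro q' hq'
  have hrow : (rowStr n (κ0 n q p c) q').length = n + 1 := by
    rw [rowStr, List.length_take, List.length_drop, length_κ0 hc, lK, min_eq_left]
    have : q' * (n + 1) + (n + 1) ≤ M n * (n + 1) := by rw [← Nat.succ_mul]; exact Nat.mul_le_mul_right _ hq'
    omega
  rw [length_fixRow, hrow]
  rw [hrow]; have := lzStr_le (delta f n q p c y); rw [length_delta hy hc hf] at this; omega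

include hy hc hf in
/-- Value of `zF`. [folklore] -/
theorem zF_W : zF f q p (Wrec n y c) = zstr f n q p c y := by
  rw [zF, catF_apply, catF_apply, fF_W q p n y c (by norm_num), kapF_W hy hc hf, fF_W q p n y c (by norm_num), zstr, xs]

include hy hc hf in
/-- `|z| = d₀`. [folklore] -/
theorem length_zstr : (zstr f n q p c y).length = d0 n := by
  rw [zstr, List.length_append, List.length_append, xs, length_fld' hc (by norm_num), length_kap hy hc hf, length_fld' hc (by norm_num),
    (len_eq n q p).2.2.1, (len_eq n q p).2.2.2.1, d0]

include hy hc hf in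
/-- Value of `vF`. [folklore] -/
theorem vF_W : vF f q p (Wrec n y c) = vstr f n q p c y := by
  rw [vF, catF_apply, catF_apply, Function.comp_apply, fanoutFn_apply, fanoutFn_apply, fanoutFn_apply, WszF_W, j1U_W, zF_W hy hc hf,
    fF_W q p n y c (by norm_num), fF_W q p n y c (by norm_num), fF_W q p n y c (by norm_num)]
  simp only [E.d0_eval, if_pos]
  rw [spliceP_apply, vstr]

include hy hc hf in
/-- `|v| = N`. [folklore] -/
theorem length_vstr : (vstr f n q p c y).length = N n := by
  have h6 : (fld' n q p c 6).length = t n * d0 n := by rw [length_fld' hc (by norm_num)]; exact (len_eq n q p).2.2.2.2.2.2.1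
  have h7 : (fld' n q p c 7).length = G2 n := by rw [length_fld' hc (by norm_num)]; exact (len_eq n q p).2.2.2.2.2.2.2.1
  have h8 : (fld' n q p c 8).length = G3 n := by rw [length_fld' hc (by norm_num)]; exact (len_eq n q p).2.2.2.2.2.2.2.2.1
  rw [vstr, List.length_append, List.length_append,
    length_splice (length_zstr hy hc hf) (by rw [h6]; exact Nat.mul_le_mul_right _ j1_lt), h6, h7, h8, N, n2]

/-- Value of `x0F`. [folklore] -/
theorem x0F_W (y c : List Bool) : x0F q p A₀ (Wrec n y c) = x0s n q p A₀ c := by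
  rw [x0F, catF_apply]
  simp only [Function.comp_apply, fanoutFn_apply, WszF_W, fF_W q p n y c (show 9 < 12 by norm_num), takeFn_boolPair, dropFn_boolPair,
    Kannan.zerosFn_apply, E.d_eval, if_pos]
  rw [x0s, fitLen]
  simp [ones]

/-- Value of `kbPF`. [folklore] -/
theorem kbPF_W (y c : List Bool) : kbPF q p (Wrec n y c) = kbP n q p c := by
  rw [kbPF, Function.comp_apply, fanoutFn_apply, fanoutFn_apply, fanoutFn_apply, WszF_W, jU_W, fF_W q p n y c (by norm_num),
    fF_W q p n y c (by norm_num)]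
  simp only [eval_mul, eval_add, eval_cst, E.R_eval, E.N_eval, if_pos]
  rw [spliceP_apply, kbP]

/-- Value of a chain record. [folklore] -/
theorem chRec_W {kbB xB : List Bool → List Bool} {kb x : List Bool} (hkb : kbB (Wrec n y c) = kb) (hx : xB (Wrec n y c) = x) :
    chRec q p kbB xB (Wrec n y c) = boolPair (Xrec n (jOf n q p c) kb x) (ones (rOf n q p c)) := by
  rw [chRec, fanoutFn_apply, fanoutFn_apply, fanoutFn_apply, fanoutFn_apply, WnF_W, hkb, hx, jU_W, rU_W, Xrec]

include hc hK in
/-- `|kbP| = p(n) ≥ K`. [folklore] -/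
theorem length_kbP : (kbP n q p c).length = p.eval n := by
  have h11 : (fld' n q p c 11).length = p.eval n := by rw [length_fld' hc (by norm_num)]; exact (len_eq n q p).2.2.2.2.2.2.2.2.2.2.2
  have h10 : (fld' n q p c 10).length = (R n + 1) * N n := by rw [length_fld' hc (by norm_num)]; exact (len_eq n q p).2.2.2.2.2.2.2.2.2.2.1
  rw [kbP, length_splice h10, h11]
  rw [h11]
  calc (jOf n q p c + 1) * ((R n + 1) * N n) ≤ Jp1 n * ((R n + 1) * N n) := Nat.mul_le_mul_right _ jOf_lt
    _ = K n := by rw [K, mul_assoc]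
    _ ≤ p.eval n := hK

include hc hK in
/-- Value of `st0F`. [cite: HaitnerEtAl2020, Lemma 5.7] -/
theorem st0F_W : st0F f q p A₀ (Wrec n y c) = st0 f n q p A₀ c := by
  rw [st0F, Function.comp_apply, chRec_W (kbPF_W y c) (x0F_W y c),
    chainUptoP_apply f (by rw [length_kbP hc hK]; exact hK) jOf_lt (by rw [x0s, length_fitLen]) rOf_le, st0]

include hc hK in
/-- `|st₀| = N`. [folklore] -/
theorem length_st0 : (st0 f n q p A₀ c).length = N n := by
  rw [st0, length_chainSt (by rw [length_kbP hc hK]; exact hK) jOf_lt (by rw [x0s, length_fitLen]) rOf_le]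

include hy hc hf hK in
/-- Value of `ykF`. [folklore] -/
theorem ykF_W : ykF f q p A₀ (Wrec n y c) = yk f n q p A₀ c y := by
  rw [ykF, Function.comp_apply, fanoutFn_apply, vF_W hy hc hf, st0F_W hc hK,
    xorStrFn_boolPair_eq_zipWith (by rw [length_vstr hy hc hf, length_st0 hc hK]), yk]

include hy hc hf hK in
/-- `|yk| = N`. [folklore] -/
theorem length_yk : (yk f n q p A₀ c y).length = N n := by
  rw [yk, List.length_zipWith, length_vstr hy hc hf, length_st0 hc hK, min_self]

include hy hc hf hK in
/-- Value of `kb1F`. [folklore] -/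
theorem kb1F_W : kb1F f q p A₀ (Wrec n y c) = kb1 f n q p A₀ c y := by
  rw [kb1F, Function.comp_apply, fanoutFn_apply, fanoutFn_apply, fanoutFn_apply, WszF_W, catF_apply, Function.comp_apply,
    fanoutFn_apply, jU_W, WszF_W, rU_W, ykF_W hy hc hf hK, kbPF_W y c]
  simp only [eval_add, eval_cst, E.R_eval, E.N_eval, if_pos]
  rw [HashBricks.umulFn_boolPair, show ones (jOf n q p c * (R n + 1)) ++ ones (rOf n q p c) = ones (jOf n q p c * (R n + 1) + rOf n q p c) by
    simp [ones], spliceP_apply, kb1]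

include hy hc hf hK in
/-- `|kb'| = p(n)`. [folklore] -/
theorem length_kb1 : (kb1 f n q p A₀ c y).length = p.eval n := by
  rw [kb1, length_splice (length_yk hy hc hf hK), length_kbP hc hK]
  rw [length_kbP hc hK]
  have h1 : (jOf n q p c * (R n + 1) + rOf n q p c) + 1 ≤ Jp1 n * (R n + 1) := by
    calc (jOf n q p c * (R n + 1) + rOf n q p c) + 1 ≤ jOf n q p c * (R n + 1) + (R n + 1) := by have := rOf_le (n := n) (q := q) (p := p) (c := c); omega
      _ = (jOf n q p c + 1) * (R n + 1) := by ring
      _ ≤ Jp1 n * (R n + 1) := Nat.mul_le_mul_right _ jOf_lt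
  calc (jOf n q p c * (R n + 1) + rOf n q p c + 1) * N n ≤ (Jp1 n * (R n + 1)) * N n := Nat.mul_le_mul_right _ h1
    _ = K n := by rw [K]
    _ ≤ p.eval n := hK

include hy hc hf hK in
/-- Value of `sF`. [folklore] -/
theorem sF_W : sF f q p A₀ (Wrec n y c) = sIdx f n q p A₀ c y := by
  rw [sF, catF_apply, WnF_W, Function.comp_apply, kb1F_W hy hc hf hK, sIdx]

include hy hc hf hK in
/-- Value of `x1F`. [folklore] -/
theorem x1F_W : x1F f q p A₀ A (Wrec n y c) = x1s f n q p A₀ A c y := by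
  have hraw : (bFn A ∘ fanoutFn (fanoutFn WnF (fanoutFn (sF f q p A₀) (fF q p 9))) (ωF q p)) (Wrec n y c) =
      A.run (boolPair (unaryEncodeNat n) (boolPair (sIdx f n q p A₀ c y) (fld' n q p c 9))) (ω n q p c) := by
    rw [Function.comp_apply, fanoutFn_apply, fanoutFn_apply, fanoutFn_apply, WnF_W, sF_W hy hc hf hK, fF_W q p n y c (by norm_num),
      ωF_W, bFn, Function.comp_apply, boolUnpair_boolPair, Function.uncurry_apply_pair, unaryEncodeNat_eq_replicate]
  rw [x1F]
  rw [catF_apply, Function.comp_apply, fanoutFn_apply, hraw, Function.comp_apply, Function.comp_apply, fanoutFn_apply, hraw, WszF_W,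
    takeFn_boolPair, dropFn_boolPair, Kannan.zerosFn_apply, x1s, fitLen]
  simp [ones]

include hy hc hf hK in
/-- Value of `st1F`. [cite: HaitnerEtAl2020, Lemma 5.7] -/
theorem st1F_W : st1F f q p A₀ A (Wrec n y c) = st1 f n q p A₀ A c y := by
  rw [st1F, Function.comp_apply, chRec_W (kb1F_W hy hc hf hK) (x1F_W hy hc hf hK),
    chainUptoP_apply f (by rw [length_kb1 hy hc hf hK]; exact hK) jOf_lt (by rw [x1s, length_fitLen]) rOf_le, st1]

include hy hc hf hK in
/-- `|st₁| = N`. [folklore] -/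
theorem length_st1 : (st1 f n q p A₀ A c y).length = N n := by
  rw [st1, length_chainSt (by rw [length_kb1 hy hc hf hK]; exact hK) jOf_lt (by rw [x1s, length_fitLen]) rOf_le]

include hy hc hf hK in
/-- Value of `v1F`. [folklore] -/
theorem v1F_W : v1F f q p A₀ A (Wrec n y c) = v1 f n q p A₀ A c y := by
  rw [v1F, Function.comp_apply, fanoutFn_apply, ykF_W hy hc hf hK, st1F_W hy hc hf hK,
    xorStrFn_boolPair_eq_zipWith (by rw [length_yk hy hc hf hK, length_st1 hy hc hf hK]), v1]

include hy hc hf hK in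
/-- Value of `xrawF`. [folklore] -/
theorem xrawF_W : xrawF f q p A₀ A (Wrec n y c) = xraw f n q p A₀ A c y := by
  rw [xrawF, Function.comp_apply, fanoutFn_apply, Function.comp_apply, fanoutFn_apply, Function.comp_apply, fanoutFn_apply, WnF_W,
    j1U_W, WszF_W, v1F_W hy hc hf hK]
  simp only [E.d0_eval, if_pos]
  rw [HashBricks.umulFn_boolPair, dropFn_boolPair, takeFn_boolPair, xraw]
  simp [ones]

include hy hc hf hK in
/-- **The inverter brick computes `Inv.out`** on `⟨⟨1ⁿ, y⟩, c⟩` with `|y| = n`, at least `pre` coins and `K ≤ p(n)`.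
[cite: HaitnerEtAl2020, Claim 4.6 with Lemmas 5.3–5.7] -/
theorem invP_apply : invP f q p A₀ A (Wrec n y c) = out f n q p A₀ A c y := by
  have hc' : (eqPairFn ∘ fanoutFn (f ∘ xrawF f q p A₀ A) WyF) (Wrec n y c) = [decide (f (xraw f n q p A₀ A c y) = y)] := by
    rw [Function.comp_apply, fanoutFn_apply, Function.comp_apply, xrawF_W hy hc hf hK, WyF_W, eqPairFn_boolPair]
  rw [invP, out]
  by_cases h : f (xraw f n q p A₀ A c y) = y
  · rw [iteFn_apply_true (by rw [hc']; simp [h]), xrawF_W hy hc hf hK, if_pos h]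
  · rw [iteFn_apply_false (by rw [hc']; simp [h]), fF_W q p n y c (by norm_num), if_neg h, xs]

end WellFormed

end Values

/-! ### Membership in `FP` -/

section MemFP

variable {f : List Bool → List Bool} (q p : Polynomial ℕ) {A₀ : List Bool → List Bool} {A : RandAlg (List Bool) (List Bool)}

/-- The length bricks are in `FP`. [folklore] -/
theorem gs_mem_FP : ∀ g ∈ gs q p, g ∈ FP :=
  List.forall_mem_cons.2 ⟨WszF_mem_FP _, List.forall_mem_cons.2 ⟨WszF_mem_FP _, List.forall_mem_cons.2 ⟨WszF_mem_FP _,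
    List.forall_mem_cons.2 ⟨WszF_mem_FP _, List.forall_mem_cons.2 ⟨WszF_mem_FP _, List.forall_mem_cons.2 ⟨WszF_mem_FP _,
    List.forall_mem_cons.2 ⟨WszF_mem_FP _, List.forall_mem_cons.2 ⟨WszF_mem_FP _, List.forall_mem_cons.2 ⟨WszF_mem_FP _,
    List.forall_mem_cons.2 ⟨WpolyF_mem_FP _, List.forall_mem_cons.2 ⟨WszF_mem_FP _, List.forall_mem_cons.2 ⟨WpolyF_mem_FP _,
    List.forall_mem_nil _⟩⟩⟩⟩⟩⟩⟩⟩⟩⟩⟩⟩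

/-- `fF q p k ∈ FP`. [folklore] -/
theorem fF_mem_FP (k : ℕ) : fF q p k ∈ FP := fldF_mem_FP (gs_mem_FP q p) k
/-- `jU q p ∈ FP`. [folklore] -/
theorem jU_mem_FP : jU q p ∈ FP := comp_mem_FP binToUnaryFn_mem_FP (fanoutFn_mem_FP (WszF_mem_FP _) (fF_mem_FP q p 0))
/-- `rU q p ∈ FP`. [folklore] -/
theorem rU_mem_FP : rU q p ∈ FP := comp_mem_FP binToUnaryFn_mem_FP (fanoutFn_mem_FP (WszF_mem_FP _) (fF_mem_FP q p 1))
/-- `iU q p ∈ FP`. [folklore] -/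
theorem iU_mem_FP : iU q p ∈ FP := comp_mem_FP binToUnaryFn_mem_FP (fanoutFn_mem_FP (WszF_mem_FP _) (fF_mem_FP q p 3))
/-- `j1U q p ∈ FP`. [folklore] -/
theorem j1U_mem_FP : j1U q p ∈ FP := comp_mem_FP binToUnaryFn_mem_FP (fanoutFn_mem_FP (WszF_mem_FP _) (fF_mem_FP q p 5))

variable (hf : f ∈ FP) (hA₀ : A₀ ∈ FP) (hA : IsPPT A id)
include hf

/-- `zF ∈ FP`. [folklore] -/
theorem zF_mem_FP : zF f q p ∈ FP := by
  have hδ : deltaF f q p ∈ FP := comp_mem_FP xorStrFn_mem_FP (fanoutFn_mem_FP WyF_mem_FP (comp_mem_FP hf (fF_mem_FP q p 2)))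
  have hκ : kapF f q p ∈ FP := comp_mem_FP fixupP_mem_FP (fanoutFn_mem_FP WnF_mem_FP (fanoutFn_mem_FP (fF_mem_FP q p 4)
    (fanoutFn_mem_FP hδ (iU_mem_FP q p))))
  exact catF_mem_FP (catF_mem_FP (fF_mem_FP q p 2) hκ) (fF_mem_FP q p 3)

/-- `vF ∈ FP`. [folklore] -/
theorem vF_mem_FP : vF f q p ∈ FP :=
  catF_mem_FP (catF_mem_FP (comp_mem_FP spliceP_mem_FP (fanoutFn_mem_FP (WszF_mem_FP _) (fanoutFn_mem_FP (j1U_mem_FP q p)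
    (fanoutFn_mem_FP (zF_mem_FP q p hf) (fF_mem_FP q p 6))))) (fF_mem_FP q p 7)) (fF_mem_FP q p 8)

omit hf in
include hA₀ in
/-- `x0F ∈ FP`. [folklore] -/
theorem x0F_mem_FP : x0F q p A₀ ∈ FP :=
  catF_mem_FP (comp_mem_FP takeFn_mem_FP (fanoutFn_mem_FP (WszF_mem_FP _) (comp_mem_FP hA₀ (fF_mem_FP q p 9))))
    (comp_mem_FP Kannan.zerosFn_mem_FP (comp_mem_FP dropFn_mem_FP (fanoutFn_mem_FP (comp_mem_FP hA₀ (fF_mem_FP q p 9)) (WszF_mem_FP _))))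

omit hf in
/-- `kbPF ∈ FP`. [folklore] -/
theorem kbPF_mem_FP : kbPF q p ∈ FP :=
  comp_mem_FP spliceP_mem_FP (fanoutFn_mem_FP (WszF_mem_FP _) (fanoutFn_mem_FP (jU_mem_FP q p) (fanoutFn_mem_FP (fF_mem_FP q p 10) (fF_mem_FP q p 11))))

omit hf in
/-- `chRec` of bricks in `FP` is in `FP`. [folklore] -/
theorem chRec_mem_FP {kbB xB : List Bool → List Bool} (hk : kbB ∈ FP) (hx : xB ∈ FP) : chRec q p kbB xB ∈ FP :=
  fanoutFn_mem_FP (fanoutFn_mem_FP (fanoutFn_mem_FP WnF_mem_FP (fanoutFn_mem_FP hk hx)) (jU_mem_FP q p)) (rU_mem_FP q p)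

include hA₀ in
/-- `ykF ∈ FP`. [folklore] -/
theorem ykF_mem_FP : ykF f q p A₀ ∈ FP :=
  comp_mem_FP xorStrFn_mem_FP (fanoutFn_mem_FP (vF_mem_FP q p hf)
    (comp_mem_FP (chainUptoP_mem_FP hf) (chRec_mem_FP q p (kbPF_mem_FP q p) (x0F_mem_FP q p hA₀))))

include hA₀ in
/-- `kb1F ∈ FP`. [folklore] -/
theorem kb1F_mem_FP : kb1F f q p A₀ ∈ FP :=
  comp_mem_FP spliceP_mem_FP (fanoutFn_mem_FP (WszF_mem_FP _) (fanoutFn_mem_FP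
    (catF_mem_FP (comp_mem_FP HashBricks.umulFn_mem_FP (fanoutFn_mem_FP (jU_mem_FP q p) (WszF_mem_FP _))) (rU_mem_FP q p))
    (fanoutFn_mem_FP (ykF_mem_FP q p hf hA₀) (kbPF_mem_FP q p))))

omit hf in
include hA in
/-- Running `A` is polynomial-time on `⟨input, coins⟩`. [cite: Goldreich2001, §1.3.2] -/
theorem bFn_mem_FP : bFn A ∈ FP := by
  show PolyTimeComputable id id (Function.uncurry A.run ∘ boolUnpair)
  exact PolyTimeComputable.comp_holds hA.1 polyTimeComputable_boolUnpair

include hA₀ hA in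
/-- `x1F ∈ FP`. [folklore] -/
theorem x1F_mem_FP : x1F f q p A₀ A ∈ FP := by
  have hs : sF f q p A₀ ∈ FP := catF_mem_FP WnF_mem_FP (comp_mem_FP (cons_mem_FP false) (kb1F_mem_FP q p hf hA₀))
  have hraw : bFn A ∘ fanoutFn (fanoutFn WnF (fanoutFn (sF f q p A₀) (fF q p 9))) (ωF q p) ∈ FP :=
    comp_mem_FP (bFn_mem_FP hA) (fanoutFn_mem_FP (fanoutFn_mem_FP WnF_mem_FP (fanoutFn_mem_FP hs (fF_mem_FP q p 9))) (restF_mem_FP (gs_mem_FP q p)))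
  exact catF_mem_FP (comp_mem_FP takeFn_mem_FP (fanoutFn_mem_FP (WszF_mem_FP _) hraw))
    (comp_mem_FP Kannan.zerosFn_mem_FP (comp_mem_FP dropFn_mem_FP (fanoutFn_mem_FP hraw (WszF_mem_FP _))))

include hA₀ hA in
/-- `xrawF ∈ FP`. [folklore] -/
theorem xrawF_mem_FP : xrawF f q p A₀ A ∈ FP := by
  have hv1 : v1F f q p A₀ A ∈ FP := comp_mem_FP xorStrFn_mem_FP (fanoutFn_mem_FP (ykF_mem_FP q p hf hA₀)
    (comp_mem_FP (chainUptoP_mem_FP hf) (chRec_mem_FP q p (kb1F_mem_FP q p hf hA₀) (x1F_mem_FP q p hf hA₀ hA))))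
  exact comp_mem_FP takeFn_mem_FP (fanoutFn_mem_FP WnF_mem_FP (comp_mem_FP dropFn_mem_FP (fanoutFn_mem_FP
    (comp_mem_FP HashBricks.umulFn_mem_FP (fanoutFn_mem_FP (j1U_mem_FP q p) (WszF_mem_FP _))) hv1)))

include hA₀ hA in
/-- **The inverter brick is in `FP`** for `f, A₀ ∈ FP` and PPT `A`. [cite: HaitnerEtAl2020, Claim 4.6 ("efficient")] -/
theorem invP_mem_FP : invP f q p A₀ A ∈ FP :=
  iteFn_mem_FP (comp_mem_FP eqPairFn_mem_FP (fanoutFn_mem_FP (comp_mem_FP hf (xrawF_mem_FP q p hf hA₀ hA)) WyF_mem_FP))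
    (xrawF_mem_FP q p hf hA₀ hA) (fF_mem_FP q p 2)

end MemFP

end Inv

/-! ### The machine -/

section Machine

variable (f : List Bool → List Bool) (q p : Polynomial ℕ) (A₀ : List Bool → List Bool) (A : RandAlg (List Bool) (List Bool))

/-- The input length `|⟨1ⁿ, ⟨s, ρ⟩⟩|` of `A` in the simulated experiment (`|s| = p(n) + n + 1`, `|ρ| = q(n)`). [folklore] -/
def lenA (n : ℕ) : ℕ := (boolPair (unaryEncodeNat n) (boolPair (ones (p.eval n + n + 1)) (ones (q.eval n)))).length

/-- The security parameter read off the inverter's input length `|⟨1ⁿ, y⟩| = 3n + 2` (for `|y| = n`). [folklore] -/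
def nOfLen (Lin : ℕ) : ℕ := (Lin - 2) / 3

/-- **The inverter** for `f` built from `(A₀, A)`: run function `invP`, coin budget = the fields plus `A`'s coins
on the simulated query (the only non-computable datum, carried by the coin count as in `YaoAmplification.lean`).
[cite: HaitnerEtAl2020, Claim 4.6 with Lemmas 5.3–5.7 and proof of Thm. 5.1, Step 5] -/
noncomputable def inverter : RandAlg (List Bool) (List Bool) where
  run inp c := Inv.invP f q p A₀ A (boolPair inp c)
  coinLen Lin := Inv.pre (nOfLen Lin) q p + A.coinLen (lenA q p (nOfLen Lin))

/-- `nOfLen (3n + 2) = n`. [folklore] -/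
theorem nOfLen_eq (n : ℕ) {y : List Bool} (hy : y.length = n) : nOfLen (boolPair (unaryEncodeNat n) y).length = n := by
  rw [length_boolPair, unaryEncodeNat_eq_replicate, List.length_replicate, hy, nOfLen]; omega

variable {f q p A₀ A}

/-- **The run function of the inverter is `Inv.out`** on `(1ⁿ, y)` with `|y| = n`, enough coins and `K ≤ p(n)`.
[cite: HaitnerEtAl2020, Claim 4.6] -/
theorem inverter_run {n : ℕ} {y c : List Bool} (hy : y.length = n) (hc : Inv.pre n q p ≤ c.length) (hf : IsLengthPreserving f)
    (hK : K n ≤ p.eval n) : (inverter f q p A₀ A).run (boolPair (unaryEncodeNat n) y) c = Inv.out f n q p A₀ A c y := by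
  show Inv.invP f q p A₀ A (boolPair (boolPair (unaryEncodeNat n) y) c) = _
  rw [unaryEncodeNat_eq_replicate, show boolPair (boolPair (List.replicate n true) y) c = Wrec n y c from rfl, Inv.invP_apply hy hc hf hK]

/-- The fields are polynomially many. [folklore] -/
theorem exists_poly_pre (q p : Polynomial ℕ) : ∃ P : Polynomial ℕ, ∀ n, Inv.pre n q p ≤ P.eval n := by
  obtain ⟨P1, h1⟩ := exists_poly_le₁ (add (add (add (add (add E.aJ E.aR) (var 0)) E.a) E.lK) E.logt)
  obtain ⟨P2, h2⟩ := exists_poly_le₁ (add (add (mul E.t E.d0) E.G2) E.G3)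
  obtain ⟨P3, h3⟩ := exists_poly_le₁ (mul (add E.R (cst 1)) E.N)
  refine ⟨P1 + P2 + q + P3 + p, fun n => ?_⟩
  have e1 := h1 n; have e2 := h2 n; have e3 := h3 n
  simp only [eval_add, eval_mul, eval_var, eval_cst, E.aJ_eval, E.aR_eval, E.a_eval, E.lK_eval, E.logt_eval, E.t_eval, E.d0_eval,
    E.G2_eval, E.G3_eval, E.R_eval, E.N_eval] at e1 e2 e3
  simp only [Inv.pre, Inv.L, List.range_succ, List.range_zero, List.map_append, List.map_cons, List.map_nil, List.sum_append,
    List.sum_cons, List.sum_nil, Inv.len, Polynomial.eval_add]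
  omega

/-- **The inverter is PPT** for `f, A₀ ∈ FP` and PPT `A`. [cite: HaitnerEtAl2020, Claim 4.6 ("efficient"); Goldreich 2001, §1.3.2] -/
theorem isPPT_inverter (hf : f ∈ FP) (hA₀ : A₀ ∈ FP) (hA : IsPPT A id) : IsPPT (inverter f q p A₀ A) id := by
  refine ⟨?_, ?_⟩
  · obtain ⟨pc, Mc, hM⟩ := Inv.invP_mem_FP q p hf hA₀ hA
    exact ⟨pc, Mc, fun z => hM (boolPair z.1 z.2)⟩
  · obtain ⟨P, hP⟩ := exists_poly_pre q p
    obtain ⟨qA, hqA⟩ := hA.2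
    -- `lenA n ≤ 2n + 2 + (2(p n + n + 1) + 2 + q n)`, a polynomial in `n ≤ Lin`
    refine ⟨P + qA.comp (C 4 * Polynomial.X + C 6 + C 2 * p + q), fun Lin => ?_⟩
    have hn : nOfLen Lin ≤ Lin := by unfold nOfLen; omega
    have h1 := hP (nOfLen Lin)
    have h2 := hqA (lenA q p (nOfLen Lin))
    have hlen : lenA q p (nOfLen Lin) = 4 * nOfLen Lin + 6 + 2 * p.eval (nOfLen Lin) + q.eval (nOfLen Lin) := by
      simp only [lenA, length_boolPair, unaryEncodeNat_eq_replicate, List.length_replicate, ones]; ring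
    show Inv.pre (nOfLen Lin) q p + A.coinLen (lenA q p (nOfLen Lin)) ≤ _
    rw [Polynomial.eval_add, Polynomial.eval_comp]
    refine Nat.add_le_add (h1.trans (TM2Iter.eval_mono P hn)) (h2.trans (TM2Iter.eval_mono qA ?_))
    rw [hlen]
    simp only [Polynomial.eval_add, Polynomial.eval_mul, Polynomial.eval_C, Polynomial.eval_X]
    have := TM2Iter.eval_mono p hn; have := TM2Iter.eval_mono q hn
    omega

end Machine

end HHRVW

end Literature.Computability.Cryptography
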